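import Literature.MathematicalPhysics.QuantumManyBody.PeriodicBoseGasFracEnergy
import Mathlib.MeasureTheory.Constructions.HaarToSphere
import Mathlib.Data.Finset.Update
import Mathlib.Data.Nat.Choose.Sum
import HarnessLib

/-!
# The coarse-mode ray (heterodyne) POVM on the `N`-particle torus

Topic `Literature/MathematicalPhysics/QuantumManyBody` (definition item `defn-CoarseModeRayPOVM`,
wanted by route `BECIroning` of `AtomisticToContinuum/BoseEinsteinCondensation`, items
`IroningLink` / `IroningCost`, cards `ironing-feedback-cooling-infrared`). Companion of
`PeriodicBoseGas.lean` (`cell`, `cellN`, `PeriodicTrialState`, `periodicEnergy`),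
`PeriodicBoseGasFourier.lean` (`cellWave`), `PeriodicBoseGasFracEnergy.lean` (`planeWaveMode`, the
normalised plane waves `φ_n = L^{-3/2} e^{2πi n·x/L}` and their API) and `OneBodyCurrentGain.lean` (one-body density and
current, phase unitaries and the gain functional, which the route applies to the conditional states
`K_z Ψ` defined here).

**The measurement.** Fix the torus of side `L`, a finite set `S ⊂ ℤ³` of `M = |S|` plane-wave modes
`φ_n = L^{-3/2} e^{2πi n·x/L}` (the *coarse* modes; `P_S` = the orthogonal projection of `L²([0,L)³)`
onto their span, `P_S^⊥ = 𝟙 - P_S` the *fine* projection) and a unit vector `z ∈ ℂ^S`, giving the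
ray mode `ψ_z = ∑_{n∈S} z_n φ_n` and `P_z = |ψ_z⟩⟨ψ_z|`. On `N` bosons the coarse/fine splitting of
the one-body space induces the sector decomposition `𝟙 = ∑_{m=0}^{N} Π_m`,
`Π_m = ∑_{|A|=m} P_S^{⊗A} ⊗ (P_S^⊥)^{⊗Aᶜ}` (exactly `m` particles coarse) — the particle-number
conserving, first-quantised form of the Fock-space factorisation `𝓕 = 𝓕^< ⊗ 𝓕^>` into the modes
`j ≤ J` and `j > J` of [LiebSeiringer2006, Sect. 3, Step 3] — and the **ray (heterodyne) Kraus map**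
`K_z = ∑_m √c_m (P_z + P_S^⊥)^{⊗N} Π_m = ∑_A √c_{|A|} P_z^{⊗A} ⊗ (P_S^⊥)^{⊗Aᶜ}`,
`c_m = dim Sym^m(ℂ^M) = C(m+M-1, m)`. Since `P_z^{⊗A}|_{Sym} = |ψ_z^{⊗m}⟩⟨ψ_z^{⊗m}|`, the effects
`K_z^*K_z = ∑_m c_m P_z^{⊗m} ⊗ (P_S^⊥)^{⊗(N-m)}` (symmetrised) integrate, over the normalised
`U(M)`-invariant measure `dσ` on the unit sphere of `ℂ^S`, to `∑_m Π_m = 𝟙` on Bose-symmetric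
functions, block by block, by the resolution of the identity of the SU(M) coherent states on
symmetric tensors, `N_{M,m} ∫ |z^{⊗m}⟩⟨z^{⊗m}| dΩ(z) = 𝟙_{Sym^m ℂ^M}` with `N_{M,m} = C(M+m-1,m)`
[BengtssonZyczkowski2017, §6.4 (6.76), §7.5 (7.59), §10.1 (10.18)] (Lieb's Bloch-state formula
`𝟙 = (2J+1)/4π ∫ dΩ |Ω⟩⟨Ω|` [Lieb1973, (2.13)–(2.14)] is `M = 2`, `m = 2J`; Simon's
`d_λ ∫ |g⟩⟨g| dg = 𝟙` the general compact-group form [Simon1980ClassicalLimit]). Thus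
`{K_z^*K_z dσ(z)}` is a POVM on `L²_sym`: it records the *direction* (ray) of the coarse field but
neither the coarse particle number `m` nor the global phase, hence conserves `N` and does not
resolve coarse–fine pairing; `K_z Ψ` is the unnormalised record-conditional state, whose one-body
density `n_z`, current `j_z` and unwinding gain are the objects of the route's LINK and COST items.

## Main definitions (namespace `Literature.MathematicalPhysics.QuantumManyBody.BoseGas`)

Everything is first-quantised and explicit: operators act on functions `Φ : (ℝ³)^N → ℂ` through
Bochner integrals over copies of the fundamental cell `[0,L)³`; no Fock space, no `L²` quotient.

* (`planeWaveMode L n = φ_n` is imported) `coarseKernel L S x y = p_S(x,y) = ∑_{n∈S} φ_n(x) conj φ_n(y)`,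
  `rayMode L S z = ψ_z`, `rayKernel L S z x y = p_z(x,y) = ψ_z(x) conj ψ_z(y)` for `z : ℂ^S`
  (`EuclideanSpace ℂ ↥S`).
* `kernelProj L C κ Φ` — `(⊗_{i∈C} Kᵢ ⊗ 𝟙)Φ` for one-body integral kernels `κᵢ` acting on the
  particles `i ∈ C ⊆ Fin N`:
  `X ↦ ∫_{cell^C} ∏_{i∈C} κᵢ(xᵢ,yᵢ) Φ(X[xᵢ := yᵢ]_{i∈C}) dy` (`Measure.pi` of `dx|_{cell}` over `C`,
  `Function.updateFinset`).
* `sectorProj L S m Φ = Π_m Φ`, written out by multilinearity of `⊗`: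
  `Π_m = ∑_{|A|=m} ∑_{B⊆Aᶜ} (-1)^{|B|} P_S^{⊗(A∪B)} ⊗ 𝟙`.
* `symDim M m = c_m = C(m+M-1,m)`; `rayKrausTerm L S z A Φ = (P_z^{⊗A} ⊗ (P_S^⊥)^{⊗Aᶜ})Φ`
  (`= ∑_{B⊆Aᶜ} (-1)^{|B|} (P_z^{⊗A} ⊗ P_S^{⊗B} ⊗ 𝟙)Φ`); `coarseModeRayPOVM L S z Φ = K_z Φ`.
* `rayMeasure S` — the normalised surface measure on the unit sphere of `ℂ^S`
  (`Measure.toSphere` of Lebesgue measure on `ℂ^S ≅ ℝ^{2M}`, divided by its mass).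

## API (all proved)

* `kernelProj_empty` (`C = ∅` gives `Φ`), `kernelProj_singleton` (one particle: the familiar
  `∫_{cell} κ(xᵢ, y) Φ(X[xᵢ := y]) dy`);
* **`sum_sectorProj`: `∑_{m=0}^{N} Π_m Φ = Φ`** for every `Φ` (Möbius inversion on the Boolean
  lattice, `sum_sum_powerset_compl_neg_one_pow_mul`; no integrability needed), `sectorProj_of_lt`
  (`Π_m = 0`, `m > N`), `rayKrausTerm_empty` (`A = ∅` term `= Π_0`);
* `symDim`: `c_0 = 1`, `c_1 = M`, `dim Sym^m ℂ = 1`, `dim Sym^m ℂ² = m + 1` (`= 2J+1`);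
* `coarseModeRayPOVM_smul_of_norm_eq_one`: `K_{cz} = K_z` for `|c| = 1` (the record is the ray),
  `coarseModeRayPOVM_zero` (`N = 0`), **`coarseModeRayPOVM_one`: for `N = 1`,
  `K_z Φ = (𝟙 - P_S)Φ + √M P_z Φ`** (so `∫‖K_zΦ‖² dσ = ‖P_S^⊥Φ‖² + M∫|⟨ψ_z,Φ⟩|² dσ = ‖Φ‖²` by
  `∫ conj(z_n) z_{n'} dσ = δ_{nn'}/M`);
* `isProbabilityMeasure_rayMeasure` (`S ≠ ∅`); Hermitian kernels, `ψ_{cz} = cψ_z`, `p_{cz} = |c|²p_z`;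
* **invariance of the record law**: for every real-linear isometry `f` of a finite-dimensional real
  inner product space, `Measure.toSphere volume` is invariant under the induced map `unitSphereMap f`
  of the unit sphere (`map_unitSphereMap_toSphere`, `measurePreserving_unitSphereMap`); hence
  `map_unitSphereMap_rayMeasure`, `measurePreserving_unitSphereMap_rayMeasure`,
  `lintegral_comp_unitSphereMap_rayMeasure` (`∫ F(f̂z) dσ = ∫ F dσ`) — `U(M)`-invariance (complex
  unitaries, coordinate permutations `LinearIsometryEquiv.piLpCongrLeft`, phase changes are
  real-linear isometries of `ℂ^S`); `integral_comp_unitSphereMap_rayMeasure` (Bochner form);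
* **second moments of the record law** (the `m = 1` block of the resolution of the identity,
  `M ∫ |ψ_z⟩⟨ψ_z| dσ = P_S`): `integral_sphere_coord_mul_conj`:
  `∫ z_n conj(z_{n'}) dσ(z) = δ_{nn'}/M` (`S ≠ ∅`), from the sum rule `∑_n ∫|z_n|² dσ = 1`,
  exchangeability of the coordinates (a transposition is an isometry) and the phase flip
  `z_n ↦ -z_n` (an isometry) — no integral is evaluated;
* `kernelProj_singleton_rayKernel`, `kernelProj_singleton_coarseKernel`: `(P_z)ᵢ`, `(P_S)ᵢ` written
  out as rank-one / finite-rank one-particle integral operators.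

## Design choices

* **First quantisation, as requested**: the route's states are `PeriodicTrialState N L`
  (functions on `(ℝ³)^N`), so `K_z` is an explicit integral operator on such functions; its value is
  again a function on `(ℝ³)^N` (periodic and `C¹` when `Φ` is — differentiation under the integral,
  left to users), to which `periodicForm`, `oneBodyDensity`, `oneBodyCurrent`, `maxPhaseGain` of
  `OneBodyCurrentGain.lean` apply verbatim.
* **Inclusion–exclusion instead of iterated one-body operators.** `P_S^⊥` has no integral kernel, and
  composing `N` one-particle operators would make even `∑_m Π_m = 𝟙` depend on Fubini and on
  integrability of every intermediate function. Expanding `(P_S^⊥)^{⊗Aᶜ} = ∑_{B⊆Aᶜ}(-1)^{|B|}P_S^{⊗B}⊗𝟙`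
  (an identity of operators) renders `Π_m` and `K_z` as finite signed sums of *single* integrals
  `kernelProj L C κ` over `cell^C`, each with a product kernel; `∑_m Π_m = 𝟙` becomes the
  combinatorial identity `∑_A ∑_{B⊆Aᶜ} (-1)^{|B|} g(A∪B) = g(∅)` and holds for every `Φ`.
* `K_z` is defined in the form `∑_A √c_{|A|} P_z^{⊗A} ⊗ (P_S^⊥)^{⊗Aᶜ}`, equal to the requested
  `∑_m √c_m (P_z + P_S^⊥)^{⊗N} Π_m` because `P_zP_S = P_z`, `P_zP_S^⊥ = P_S^⊥P_S = 0` (`‖z‖ = 1`).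
* `z` ranges over all of `ℂ^S` in the definitions (polynomial dependence, `K_{cz}` scales as
  `|c|^{2|A|}` termwise); the record space is the unit sphere `Metric.sphere 0 1` with `rayMeasure`,
  and users integrate `z ↦ F (K_{↑z} Φ)` over `↥(sphere 0 1)`. The measure is Mathlib's
  `Measure.toSphere` (invariant under the real orthogonal group of `ℂ^S ≅ ℝ^{2M}`, in particular under
  `U(M)`), normalised; its image on rays is the normalised Fubini–Study measure of (7.59).
* `L` explicit, `N` implicit (read off `Φ`), `S : Finset (Fin 3 → ℤ)` arbitrary (the route takes
  the cube `|n|_∞ ≤ R`, zero mode included); all integrals are over the fundamental cell, as in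
  `periodicEnergy`, so periodic `Φ` are functions on the torus.
* **Deliberately not here** (no named facts are introduced): (i) the POVM identity
  `∫ ‖K_zΨ‖²_{L²(cell^N)} dσ(z) = ‖Ψ‖²` for Bose-symmetric `Ψ` — it is the resolution of the identity
  (7.59) block by block and reduces, in coordinates, to the sphere moments
  `∫_{S^{2M-1}} z^α conj(z)^β dσ = δ_{αβ} α!(M-1)!/(M-1+|α|)!` plus Fubini and the plane-wave
  orthonormality on the cell; a `--supports` lemma of the route (the `N = 1` case is displayed
  above; tools: the invariance lemmas here, the Gaussian/sphere calculus of
  `Literature.Probability.Distributions.GaussianSphereMarginal` and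
  `Literature.Probability.RandomMatrix.SphereCoordinateDensity` — law of a coordinate block of a
  uniform point of a complex sphere — and `nnnorm_sq_integral_conj_planeWaveMode_mul` of
  `PeriodicBoseGasFracEnergy.lean`); (ii) the compositional calculus of `kernelProj` (Fubini over disjoint particle sets,
  `MeasurableEquiv.piFinsetUnion`), self-adjointness and idempotency of `Π_m`; (iii) regularity of
  `K_zΦ`; (iv) the upper/lower symbol calculus of the cost lemma [LiebSeiringerYngvason2005],
  [LiebSeiringer2006, Sect. 3 Step 3]; (v) second quantisation (`TorusBoseFockLayer.lean` is the
  tree's algebraic Fock layer and is not needed here).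
* Mathlib has POVMs neither abstractly nor concretely, no coherent states and no symmetric tensor
  powers of `L²` (searched `POVM`, `coherentState`, `Kraus`, `SymmetricPower`); `Measure.toSphere`,
  `Measure.pi`, `Function.updateFinset`, `EuclideanSpace`, `Finset.powersetCard` are Mathlib's.

## References

* [BengtssonZyczkowski2017] I. Bengtsson, K. Życzkowski, *Geometry of Quantum States*, 2nd ed.,
  CUP 2017: §6.4 (6.71)–(6.76) (SU(K) coherent states on symmetric tensors, `N_{K,m} = C(K+m-1,m)`),
  §7.5 (7.59) (`N_{K,m} ∫ dΩ |⟨ψ|z⟩|² = 1`, normalised FS measure), §7.6 (7.64), §10.1 (10.18)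
  (the coherent-state POVM `∫ |x⟩⟨x| dx = 𝟙`).
* [Lieb1973] E. H. Lieb, *The classical limit of quantum spin systems*, Comm. Math. Phys. 31 (1973)
  327–340: (2.7), (2.13)–(2.15).
* [Simon1980ClassicalLimit] B. Simon, *The classical limit of quantum partition functions*, Comm.
  Math. Phys. 71 (1980) 247–276.
* [LiebSeiringer2006] E. H. Lieb, R. Seiringer, *Derivation of the Gross–Pitaevskii equation for
  rotating Bose gases*, Comm. Math. Phys. 264 (2006) 505–537 (arXiv:math-ph/0504042): Sect. 3,
  Step 3 (`𝓕 = 𝓕^< ⊗ 𝓕^>`, coherent states on the modes `j ≤ J`, `∫ dz Π(z) = 𝟙_{𝓕^<}`).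
* [LiebSeiringerYngvason2005] E. H. Lieb, R. Seiringer, J. Yngvason, *Justification of c-number
  substitutions in bosonic Hamiltonians*, Phys. Rev. Lett. 94 (2005) 080401.
* [LSSY2005] E. H. Lieb, R. Seiringer, J. P. Solovej, J. Yngvason, *The Mathematics of the Bose Gas
  and its Condensation*, Birkhäuser 2005: §5.2 (5.19)–(5.24).
-/

noncomputable section

open MeasureTheory Metric
open scoped ENNReal NNReal ComplexConjugate Pointwise

namespace Literature.MathematicalPhysics.QuantumManyBody.BoseGas

variable {N : ℕ}

/-! ### One-body data: the coarse projection `P_S` and the ray `ψ_z` -/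

/-- The integral kernel `p_S(x, y) = ∑_{n ∈ S} φ_n(x) conj(φ_n(y))` of the **coarse projection**
`P_S`, the orthogonal projection of `L²([0,L)³)` onto the span of the finitely many plane waves
`φ_n`, `n ∈ S ⊂ ℤ³` (the "modes `j ≤ J`" of the coarse/fine splitting `𝓕 = 𝓕^< ⊗ 𝓕^>`).
[cite: LiebSeiringer2006, Sect. 3 Step 3] -/
def coarseKernel (L : ℝ) (S : Finset (Fin 3 → ℤ)) (x y : Space) : ℂ :=
  ∑ n ∈ S, planeWaveMode L n x * conj (planeWaveMode L n y)

/-- The **ray mode** `ψ_z = ∑_{n ∈ S} z_n φ_n` of a coefficient vector `z ∈ ℂ^S` (a unit vector of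
`ran P_S` when `‖z‖ = 1`): the one-body state onto which the SU(M)-coherent ("ray") measurement
projects the coarse particles. [cite: BengtssonZyczkowski2017, §6.4 (6.71)–(6.76)] -/
def rayMode (L : ℝ) (S : Finset (Fin 3 → ℤ)) (z : EuclideanSpace ℂ ↥S) (x : Space) : ℂ :=
  ∑ n : ↥S, z n * planeWaveMode L (n : Fin 3 → ℤ) x

/-- The integral kernel `p_z(x, y) = ψ_z(x) conj(ψ_z(y))` of the rank-one operator `P_z = |ψ_z⟩⟨ψ_z|`
(an orthogonal projection when `‖z‖ = 1`). [cite: BengtssonZyczkowski2017, §10.1 (10.18)] -/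
def rayKernel (L : ℝ) (S : Finset (Fin 3 → ℤ)) (z : EuclideanSpace ℂ ↥S) (x y : Space) : ℂ :=
  rayMode L S z x * conj (rayMode L S z y)

/-! ### Product-kernel integral operators on `N`-body functions -/

/-- **One-body kernels acting on a set `C` of particles**:
`(kernelProj L C κ Φ)(X) = ∫_{[0,L)^{3|C|}} (∏_{i ∈ C} κᵢ(xᵢ, yᵢ)) Φ(X[xᵢ := yᵢ, i ∈ C]) ∏_{i∈C} dyᵢ`,
i.e. the operator `(⊗_{i ∈ C} Kᵢ) ⊗ 𝟙_{Cᶜ}` on `L²([0,L)^{3N})` where `Kᵢ` is the one-body integral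
operator with kernel `κᵢ` acting in the `i`-th particle variable (first quantisation: no Fock space).
The integral is a Bochner integral for the product of the Lebesgue measures restricted to the
cell over the coordinates in `C` (`Function.updateFinset` substitutes them); for `C = ∅` it is
`Φ` itself (`kernelProj_empty`). [cite: LiebSeiringer2006, Sect. 3 Step 3] -/
def kernelProj (L : ℝ) (C : Finset (Fin N)) (κ : Fin N → Space → Space → ℂ) (Φ : Config N → ℂ)
    (X : Config N) : ℂ :=
  ∫ y : ↥C → Space, (∏ i : ↥C, κ i (X i) (y i)) * Φ (Function.updateFinset X C y)
    ∂Measure.pi fun _ : ↥C => (volume : Measure Space).restrict (cell L)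

/-- **The sector projection** `Π_m`, `0 ≤ m ≤ N`: the component of an `N`-body function with
exactly `m` particles in `ran P_S` (coarse) and `N - m` particles in `ran (𝟙 - P_S)` (fine),
`Π_m = ∑_{A ⊆ {1..N}, |A| = m} P_S^{⊗A} ⊗ (𝟙 - P_S)^{⊗Aᶜ}` (the symmetrised
`P_S^{⊗m} ⊗ (P_S^⊥)^{⊗(N-m)}` with its binomial multiplicity), written out by multilinearity,
`(𝟙 - P_S)^{⊗Aᶜ} = ∑_{B ⊆ Aᶜ} (-1)^{|B|} P_S^{⊗B} ⊗ 𝟙`, as a finite signed sum of the explicit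
integral operators `kernelProj L (A ∪ B) p_S`. `∑_m Π_m = 𝟙` (`sum_sectorProj`). This is the
particle-number-conserving (first-quantised) form of the splitting `𝓕 = 𝓕^< ⊗ 𝓕^>` of Fock space
into coarse and fine modes. [cite: LiebSeiringer2006, Sect. 3 Step 3] -/
def sectorProj (L : ℝ) (S : Finset (Fin 3 → ℤ)) (m : ℕ) (Φ : Config N → ℂ) (X : Config N) : ℂ :=
  ∑ A ∈ (Finset.univ : Finset (Fin N)).powersetCard m, ∑ B ∈ Aᶜ.powerset,
    (-1 : ℂ) ^ B.card * kernelProj L (A ∪ B) (fun _ => coarseKernel L S) Φ X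

/-- `symDim M m = dim Sym^m(ℂ^M) = C(m + M - 1, m)`, the dimension of the `m`-boson sector over `M`
modes ("the number of ways of distributing `m` identical objects in `M` boxes"), the normalising
constant `N_{K,m}` of the SU(M)-coherent-state resolution of the identity on symmetric tensors
(`2J + 1` for `M = 2`, `m = 2J`). [cite: BengtssonZyczkowski2017, §6.4 (6.76)] -/
def symDim (M m : ℕ) : ℕ :=
  (m + M - 1).choose m

/-- The `A`-term of the ray Kraus map: `P_z^{⊗A} ⊗ (𝟙 - P_S)^{⊗Aᶜ}` applied to `Φ` — the particles in
`A` are projected onto the ray `ψ_z`, all others onto the fine sector — expanded by multilinearity as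
`∑_{B ⊆ Aᶜ} (-1)^{|B|} (P_z^{⊗A} ⊗ P_S^{⊗B} ⊗ 𝟙)Φ` in terms of `kernelProj` (kernel `p_z` on `A`,
`p_S` on `B`). [cite: LiebSeiringer2006, Sect. 3 Step 3] -/
def rayKrausTerm (L : ℝ) (S : Finset (Fin 3 → ℤ)) (z : EuclideanSpace ℂ ↥S) (A : Finset (Fin N))
    (Φ : Config N → ℂ) (X : Config N) : ℂ :=
  ∑ B ∈ Aᶜ.powerset, (-1 : ℂ) ^ B.card *
    kernelProj L (A ∪ B) (fun i => if i ∈ A then rayKernel L S z else coarseKernel L S) Φ X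

/-- **The coarse-mode ray (heterodyne) POVM**, presented by its Kraus map in first quantisation:
for a finite set `S ⊂ ℤ³` of `M = |S|` plane-wave modes of the torus of side `L` and `z ∈ ℂ^S`,
`K_z Φ = ∑_{m=0}^{N} √c_m (P_z + P_S^⊥)^{⊗N} Π_m Φ = ∑_{A ⊆ {1..N}} √c_{|A|} (P_z^{⊗A} ⊗ (𝟙 - P_S)^{⊗Aᶜ}) Φ`,
`c_m = symDim M m = dim Sym^m(ℂ^M)` (the two forms agree because `P_z P_S = P_z` and
`P_z P_S^⊥ = P_S^⊥ P_S = 0` for `‖z‖ = 1`). On Bose-symmetric `Φ` and for `z` on the unit sphere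
`S^{2M-1} ⊂ ℂ^S` with its normalised `U(M)`-invariant measure `rayMeasure S`, the effects
`K_z^* K_z = ∑_m c_m P_z^{⊗m} ⊗ (P_S^⊥)^{⊗(N-m)}` (symmetrised) integrate to `𝟙`, blockwise in `m`, by
the resolution of the identity `N_{M,m} ∫ |z^{⊗m}⟩⟨z^{⊗m}| dΩ(z) = 𝟙_{Sym^m}` of the SU(M) coherent
states (Lieb's `𝟙 = (2J+1)/4π ∫ dΩ |Ω⟩⟨Ω|` for `M = 2`): the measurement records the *direction* (ray)
of the coarse field `∑_{n∈S} a_n φ_n` but neither the coarse particle number `m` nor the global phase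
(`coarseModeRayPOVM_smul_of_norm_eq_one`). `K_z Φ` is the unnormalised record-conditional state.
[cite: BengtssonZyczkowski2017, §7.5 (7.59) and §10.1 (10.18)] -/
def coarseModeRayPOVM (L : ℝ) (S : Finset (Fin 3 → ℤ)) (z : EuclideanSpace ℂ ↥S)
    (Φ : Config N → ℂ) (X : Config N) : ℂ :=
  ∑ A : Finset (Fin N), (Real.sqrt (symDim S.card A.card) : ℂ) * rayKrausTerm L S z A Φ X

/-- **The record space and its law**: the normalised `U(M)`-invariant (surface) measure on the unit
sphere `S^{2M-1} = {z ∈ ℂ^S : ‖z‖ = 1}` of `ℂ^S` — Mathlib's `Measure.toSphere` of Lebesgue measure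
on `ℂ^S ≅ ℝ^{2M}`, divided by its total mass `2M·|B_1|`; a probability measure for `S ≠ ∅`
(`isProbabilityMeasure_rayMeasure`). Its image on rays `ℂP^{M-1}` is the normalised Fubini–Study
measure `dΩ_{M-1}` of the resolution of the identity. [cite: BengtssonZyczkowski2017, §7.5 (7.59), §7.6 (7.64)] -/
def rayMeasure (S : Finset (Fin 3 → ℤ)) : Measure ↥(sphere (0 : EuclideanSpace ℂ ↥S) 1) :=
  ((volume : Measure (EuclideanSpace ℂ ↥S)).toSphere Set.univ)⁻¹ •
    (volume : Measure (EuclideanSpace ℂ ↥S)).toSphere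

/-! ### API: one-body data -/

section OneBody

variable {L : ℝ} {S : Finset (Fin 3 → ℤ)}

/-- The coarse kernel is Hermitian: `conj p_S(x, y) = p_S(y, x)`. [folklore] -/
theorem conj_coarseKernel (L : ℝ) (S : Finset (Fin 3 → ℤ)) (x y : Space) :
    conj (coarseKernel L S x y) = coarseKernel L S y x := by
  simp only [coarseKernel, map_sum, map_mul, Complex.conj_conj]
  exact Finset.sum_congr rfl fun n _ => mul_comm _ _

/-- The ray kernel is Hermitian: `conj p_z(x, y) = p_z(y, x)`. [folklore] -/
theorem conj_rayKernel (L : ℝ) (S : Finset (Fin 3 → ℤ)) (z : EuclideanSpace ℂ ↥S) (x y : Space) :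
    conj (rayKernel L S z x y) = rayKernel L S z y x := by
  simp only [rayKernel, map_mul, Complex.conj_conj]
  exact mul_comm _ _

/-- `ψ_{cz} = c ψ_z`: the ray mode is linear in the coefficient vector. [folklore] -/
theorem rayMode_smul (L : ℝ) (S : Finset (Fin 3 → ℤ)) (c : ℂ) (z : EuclideanSpace ℂ ↥S) (x : Space) :
    rayMode L S (c • z) x = c * rayMode L S z x := by
  simp only [rayMode, PiLp.smul_apply, smul_eq_mul, Finset.mul_sum, mul_assoc]

/-- `p_{cz} = |c|² p_z`. [folklore] -/
theorem rayKernel_smul (L : ℝ) (S : Finset (Fin 3 → ℤ)) (c : ℂ) (z : EuclideanSpace ℂ ↥S)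
    (x y : Space) : rayKernel L S (c • z) x y = (‖c‖ ^ 2 : ℝ) * rayKernel L S z x y := by
  simp only [rayKernel, rayMode_smul, map_mul]
  have h : (c * conj c : ℂ) = ((‖c‖ ^ 2 : ℝ) : ℂ) := by
    rw [Complex.mul_conj, Complex.normSq_eq_norm_sq]
  rw [← h]
  ring

/-- **Global phases are not recorded**: `p_{cz} = p_z` for `|c| = 1`, so the Kraus map depends on `z`
only through the ray `ℂz` (a point of `ℂP^{M-1}`). [cite: BengtssonZyczkowski2017, §6.4 (6.71)–(6.76)] -/
theorem rayKernel_smul_of_norm_eq_one (L : ℝ) (S : Finset (Fin 3 → ℤ)) {c : ℂ} (hc : ‖c‖ = 1)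
    (z : EuclideanSpace ℂ ↥S) : rayKernel L S (c • z) = rayKernel L S z := by
  funext x y
  rw [rayKernel_smul, hc, one_pow, Complex.ofReal_one, one_mul]

end OneBody

/-! ### API: the integral operators and the sector decomposition -/

section Sectors

variable {L : ℝ} {S : Finset (Fin 3 → ℤ)}

/-- No particle acted on: `kernelProj L ∅ κ Φ = Φ` (the empty product measure is a Dirac mass and
`X[∅ := ·] = X`). [folklore] -/
@[simp]
theorem kernelProj_empty (L : ℝ) (κ : Fin N → Space → Space → ℂ) (Φ : Config N → ℂ) :
    kernelProj L ∅ κ Φ = Φ := by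
  funext X
  simp only [kernelProj, Finset.univ_eq_empty, Finset.prod_empty, one_mul,
    Function.updateFinset_empty]
  rw [Measure.pi_of_empty, integral_dirac]

/-- One particle acted on: `(kernelProj L {i} κ Φ)(X) = ∫_{[0,L)³} κᵢ(xᵢ, y) Φ(X[xᵢ := y]) dy`, the
one-body integral operator with kernel `κᵢ` in the `i`-th variable. [folklore] -/
theorem kernelProj_singleton (L : ℝ) (i : Fin N) (κ : Fin N → Space → Space → ℂ)
    (Φ : Config N → ℂ) (X : Config N) :
    kernelProj L {i} κ Φ X = ∫ y in cell L, κ i (X i) y * Φ (Function.update X i y) := by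
  unfold kernelProj
  rw [← ((measurePreserving_piUnique fun _ : ↥({i} : Finset (Fin N)) =>
      (volume : Measure Space).restrict (cell L)).symm _).integral_comp'
    (f := (MeasurableEquiv.piUnique fun _ : ↥({i} : Finset (Fin N)) => Space).symm)]
  congr 1
  funext y
  rw [Function.updateFinset_singleton, Fintype.prod_unique]
  rfl

/-- **Möbius inversion on the Boolean lattice**, in the form behind the sector decomposition:
`∑_A ∑_{B ⊆ Aᶜ} (-1)^{|B|} g(A ∪ B) = g(∅)` (substitute `C = A ∪ B` and use
`∑_{B ⊆ C} (-1)^{|B|} = [C = ∅]`). [folklore] -/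
theorem sum_sum_powerset_compl_neg_one_pow_mul {ι : Type*} [Fintype ι] [DecidableEq ι]
    {R : Type*} [CommRing R] (g : Finset ι → R) :
    ∑ A : Finset ι, ∑ B ∈ Aᶜ.powerset, (-1 : R) ^ B.card * g (A ∪ B) = g ∅ := by
  calc ∑ A : Finset ι, ∑ B ∈ Aᶜ.powerset, (-1 : R) ^ B.card * g (A ∪ B)
      = ∑ B : Finset ι, ∑ A ∈ Bᶜ.powerset, (-1 : R) ^ B.card * g (A ∪ B) := by
        refine Finset.sum_comm' fun A B => ?_
        simp only [Finset.mem_univ, true_and, and_true, Finset.mem_powerset]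
        exact Finset.subset_compl_comm
    _ = ∑ B : Finset ι, ∑ C ∈ Finset.univ.filter (fun C => B ⊆ C), (-1 : R) ^ B.card * g C := by
        refine Finset.sum_congr rfl fun B _ => ?_
        refine Finset.sum_bij' (fun A _ => A ∪ B) (fun C _ => C \ B) ?_ ?_ ?_ ?_ ?_
        · intro A _
          simp only [Finset.mem_filter, Finset.mem_univ, true_and]
          exact Finset.subset_union_right
        · intro C _
          rw [Finset.mem_powerset]
          intro x hx
          rw [Finset.mem_compl]
          exact (Finset.mem_sdiff.mp hx).2
        · intro A hA
          rw [Finset.mem_powerset] at hA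
          exact Finset.union_sdiff_cancel_right (Finset.disjoint_left.mpr fun x hxA hxB =>
            (Finset.mem_compl.mp (hA hxA)) hxB)
        · intro C hC
          simp only [Finset.mem_filter, Finset.mem_univ, true_and] at hC
          exact Finset.sdiff_union_of_subset hC
        · intro A _
          rfl
    _ = ∑ C : Finset ι, ∑ B ∈ C.powerset, (-1 : R) ^ B.card * g C := by
        refine Finset.sum_comm' fun B C => ?_
        simp only [Finset.mem_univ, true_and, and_true, Finset.mem_filter, Finset.mem_powerset]
    _ = ∑ C : Finset ι, (if C = ∅ then g C else 0) := by
        refine Finset.sum_congr rfl fun C _ => ?_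
        rw [← Finset.sum_mul]
        have h := congrArg (Int.cast : ℤ → R) (Finset.sum_powerset_neg_one_pow_card (x := C))
        push_cast at h
        rw [h]
        split_ifs <;> simp
    _ = g ∅ := by
        rw [Finset.sum_ite_eq']
        simp

/-- The powerset of `univ` graded by cardinality: `∑_{m=0}^{N} ∑_{|A| = m} F(A) = ∑_A F(A)`.
[folklore] -/
theorem sum_range_sum_powersetCard_univ {R : Type*} [AddCommMonoid R] (F : Finset (Fin N) → R) :
    ∑ m ∈ Finset.range (N + 1), ∑ A ∈ (Finset.univ : Finset (Fin N)).powersetCard m, F A =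
      ∑ A : Finset (Fin N), F A := by
  have h := Finset.powerset_card_disjiUnion (Finset.univ : Finset (Fin N))
  rw [Finset.powerset_univ] at h
  conv_rhs => rw [h]
  rw [Finset.sum_disjiUnion, Finset.card_univ, Fintype.card_fin]

/-- **The sectors exhaust the space**: `∑_{m=0}^{N} Π_m Φ = Φ` for every `N`-body function `Φ`
(`∏ᵢ (P_S + P_S^⊥)ᵢ = 𝟙` expanded; an identity of the defining signed sums, valid without any
integrability hypothesis). [cite: LiebSeiringer2006, Sect. 3 Step 3] -/
theorem sum_sectorProj (L : ℝ) (S : Finset (Fin 3 → ℤ)) (Φ : Config N → ℂ) (X : Config N) :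
    ∑ m ∈ Finset.range (N + 1), sectorProj L S m Φ X = Φ X := by
  have h := sum_sum_powerset_compl_neg_one_pow_mul
    (fun C => kernelProj L C (fun _ => coarseKernel L S) Φ X)
  rw [kernelProj_empty] at h
  simp only [sectorProj]
  exact (sum_range_sum_powersetCard_univ _).trans h

/-- There is no sector with more coarse particles than particles: `Π_m = 0` for `m > N`. [folklore] -/
theorem sectorProj_of_lt (L : ℝ) (S : Finset (Fin 3 → ℤ)) {m : ℕ} (hm : N < m) (Φ : Config N → ℂ) :
    sectorProj L S m Φ = 0 := by
  funext X
  simp only [sectorProj, Pi.zero_apply]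
  rw [Finset.powersetCard_eq_empty.mpr (by simpa using hm), Finset.sum_empty]

/-- The all-fine term of the Kraus map is the sector `m = 0`: `P_z^{⊗∅} ⊗ (𝟙 - P_S)^{⊗N} = Π_0`.
[folklore] -/
theorem rayKrausTerm_empty (L : ℝ) (S : Finset (Fin 3 → ℤ)) (z : EuclideanSpace ℂ ↥S)
    (Φ : Config N → ℂ) (X : Config N) :
    rayKrausTerm L S z ∅ Φ X = sectorProj L S 0 Φ X := by
  simp only [rayKrausTerm, sectorProj, Finset.powersetCard_zero, Finset.sum_singleton,
    Finset.notMem_empty, if_false, Finset.compl_empty, Finset.empty_union]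

end Sectors

/-! ### API: the Kraus map -/

section Kraus

variable {L : ℝ} {S : Finset (Fin 3 → ℤ)}

/-- `c_0 = 1`: the vacuum of the coarse modes is one-dimensional. [cite: BengtssonZyczkowski2017, §6.4 (6.76)] -/
@[simp]
theorem symDim_zero_right (M : ℕ) : symDim M 0 = 1 := by
  simp [symDim]

/-- `c_1 = M`: one coarse particle has `M` states. [cite: BengtssonZyczkowski2017, §6.4 (6.76)] -/
@[simp]
theorem symDim_one_right (M : ℕ) : symDim M 1 = M := by
  simp [symDim]

/-- One mode: `dim Sym^m(ℂ) = 1`. [cite: BengtssonZyczkowski2017, §6.4 (6.76)] -/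
@[simp]
theorem symDim_one_left (m : ℕ) : symDim 1 m = 1 := by
  simp [symDim]

/-- Two modes (spin `J = m/2`): `dim Sym^m(ℂ²) = m + 1 = 2J + 1`, Lieb's normalisation of the Bloch
coherent states. [cite: Lieb1973, (2.13)–(2.14)] -/
@[simp]
theorem symDim_two_left (m : ℕ) : symDim 2 m = m + 1 := by
  simp [symDim, Nat.choose_succ_self_right]

/-- **Global phases are not recorded**: `K_{cz} = K_z` for `|c| = 1`; the record is the ray `ℂz`.
[cite: BengtssonZyczkowski2017, §7.5 (7.59)] -/
theorem coarseModeRayPOVM_smul_of_norm_eq_one (L : ℝ) (S : Finset (Fin 3 → ℤ)) {c : ℂ}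
    (hc : ‖c‖ = 1) (z : EuclideanSpace ℂ ↥S) :
    (coarseModeRayPOVM L S (c • z) : (Config N → ℂ) → Config N → ℂ) = coarseModeRayPOVM L S z := by
  funext Φ X
  simp only [coarseModeRayPOVM, rayKrausTerm, rayKernel_smul_of_norm_eq_one L S hc]

/-- Without particles the Kraus map is the identity (`K_z = √c_0 · 𝟙` on `ℂ`). [folklore] -/
theorem coarseModeRayPOVM_zero (L : ℝ) (S : Finset (Fin 3 → ℤ)) (z : EuclideanSpace ℂ ↥S)
    (Φ : Config 0 → ℂ) : coarseModeRayPOVM L S z Φ = Φ := by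
  funext X
  rw [coarseModeRayPOVM, Fintype.sum_subsingleton _ (∅ : Finset (Fin 0))]
  simp [rayKrausTerm]

/-- **One particle** (`N = 1`): `K_z Φ = (𝟙 - P_S)Φ + √M · P_z Φ` — the fine part is kept, the coarse
part is projected onto the ray and reweighted by `√c_1 = √M`; written with the one-body integral
operators in the single particle variable. [cite: BengtssonZyczkowski2017, §7.5 (7.59)] -/
theorem coarseModeRayPOVM_one (L : ℝ) (S : Finset (Fin 3 → ℤ)) (z : EuclideanSpace ℂ ↥S)
    (Φ : Config 1 → ℂ) (X : Config 1) :
    coarseModeRayPOVM L S z Φ X =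
      (Φ X - ∫ y in cell L, coarseKernel L S (X 0) y * Φ (Function.update X 0 y)) +
        (Real.sqrt S.card : ℂ) * ∫ y in cell L, rayKernel L S z (X 0) y * Φ (Function.update X 0 y) := by
  have huniv : (Finset.univ : Finset (Fin 1)) = {0} := Finset.univ_unique
  have hps : ∀ f : Finset (Fin 1) → ℂ, ∑ A ∈ ({0} : Finset (Fin 1)).powerset, f A = f ∅ + f {0} := by
    intro f
    rw [← Finset.insert_empty, Finset.sum_powerset_insert (Finset.notMem_empty _),
      Finset.powerset_empty, Finset.sum_singleton, Finset.sum_singleton, Finset.insert_empty]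
  have hc : ({0} : Finset (Fin 1))ᶜ = ∅ := by rw [Finset.compl_eq_empty_iff, huniv]
  rw [coarseModeRayPOVM, ← Finset.powerset_univ, huniv, hps]
  simp only [rayKrausTerm, Finset.compl_empty, huniv, hc, hps, Finset.powerset_empty,
    Finset.sum_singleton, Finset.card_empty, Finset.card_singleton, pow_zero, pow_one, one_mul,
    Finset.empty_union, Finset.union_empty, kernelProj_empty, symDim_zero_right, symDim_one_right,
    Nat.cast_one, Real.sqrt_one, Complex.ofReal_one, Finset.notMem_empty, if_false,
    kernelProj_singleton, Finset.mem_singleton, if_true, neg_mul]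
  ring

end Kraus

/-! ### API: invariance of the sphere measure under linear isometries -/

section SphereInvariance

variable {E : Type*} [NormedAddCommGroup E] [InnerProductSpace ℝ E]

/-- A linear isometry maps the unit sphere into itself. [folklore] -/
theorem mem_unitSphere_of_linearIsometryEquiv (f : E ≃ₗᵢ[ℝ] E) (z : E) (hz : z ∈ sphere (0 : E) 1) :
    f z ∈ sphere (0 : E) 1 := by
  rw [mem_sphere_zero_iff_norm] at hz ⊢
  rw [f.norm_map, hz]

/-- **The action of a linear isometry on the unit sphere** `z ↦ f z` (for `E = ℂ^S` viewed as a real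
inner product space this includes the unitary group `U(M)` and complex conjugations). [folklore] -/
def unitSphereMap (f : E ≃ₗᵢ[ℝ] E) : ↥(sphere (0 : E) 1) → ↥(sphere (0 : E) 1) :=
  Subtype.map f (mem_unitSphere_of_linearIsometryEquiv f)

/-- Unfolding: `↑(unitSphereMap f z) = f z`. [folklore] -/
@[simp]
theorem coe_unitSphereMap (f : E ≃ₗᵢ[ℝ] E) (z : ↥(sphere (0 : E) 1)) :
    (unitSphereMap f z : E) = f z := rfl

/-- `unitSphereMap f` is continuous. [folklore] -/
theorem continuous_unitSphereMap (f : E ≃ₗᵢ[ℝ] E) : Continuous (unitSphereMap f) :=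
  (f.continuous.comp continuous_subtype_val).subtype_mk _

/-- `unitSphereMap` is compatible with composition: `(f.trans g)^ = ĝ ∘ f̂`. [folklore] -/
theorem unitSphereMap_trans (f g : E ≃ₗᵢ[ℝ] E) :
    unitSphereMap (f.trans g) = unitSphereMap g ∘ unitSphereMap f := by
  funext z
  exact Subtype.ext rfl

/-- `f̂⁻¹ ∘ f̂ = id` on the sphere. [folklore] -/
@[simp]
theorem unitSphereMap_symm_apply (f : E ≃ₗᵢ[ℝ] E) (z : ↥(sphere (0 : E) 1)) :
    unitSphereMap f.symm (unitSphereMap f z) = z :=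
  Subtype.ext (f.symm_apply_apply z)

/-- `f̂ ∘ f̂⁻¹ = id` on the sphere. [folklore] -/
@[simp]
theorem unitSphereMap_apply_symm (f : E ≃ₗᵢ[ℝ] E) (z : ↥(sphere (0 : E) 1)) :
    unitSphereMap f (unitSphereMap f.symm z) = z :=
  Subtype.ext (f.apply_symm_apply z)

/-- The cone bookkeeping: `val '' (f̂ ⁻¹' s) = f ⁻¹' (val '' s)`. [folklore] -/
theorem image_val_preimage_unitSphereMap (f : E ≃ₗᵢ[ℝ] E) (s : Set ↥(sphere (0 : E) 1)) :
    Subtype.val '' (unitSphereMap f ⁻¹' s) = f ⁻¹' (Subtype.val '' s) := by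
  ext x
  simp only [Set.mem_image, Set.mem_preimage, Subtype.exists, exists_and_right, exists_eq_right]
  constructor
  · rintro ⟨hx, hs⟩
    exact ⟨mem_unitSphere_of_linearIsometryEquiv f x hx, hs⟩
  · rintro ⟨hfx, hs⟩
    have hx : x ∈ sphere (0 : E) 1 := by
      rw [mem_sphere_zero_iff_norm] at hfx ⊢
      rw [← f.norm_map, hfx]
    exact ⟨hx, hs⟩

/-- Radial scalings commute with linear maps: `(0,1) • f ⁻¹' T = f ⁻¹' ((0,1) • T)`. [folklore] -/
theorem Ioo_smul_preimage_linearIsometryEquiv (f : E ≃ₗᵢ[ℝ] E) (T : Set E) :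
    Set.Ioo (0 : ℝ) 1 • f ⁻¹' T = f ⁻¹' (Set.Ioo (0 : ℝ) 1 • T) := by
  ext x
  simp only [Set.mem_smul, Set.mem_preimage]
  constructor
  · rintro ⟨t, ht, y, hy, rfl⟩
    exact ⟨t, ht, f y, hy, by rw [map_smul]⟩
  · rintro ⟨t, ht, w, hw, hx⟩
    refine ⟨t, ht, f.symm w, by simpa using hw, ?_⟩
    apply f.injective
    rw [map_smul, f.apply_symm_apply, hx]

variable [FiniteDimensional ℝ E] [MeasurableSpace E] [BorelSpace E]

omit [FiniteDimensional ℝ E] in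
/-- `unitSphereMap f` is measurable. [folklore] -/
theorem measurable_unitSphereMap (f : E ≃ₗᵢ[ℝ] E) : Measurable (unitSphereMap f) :=
  (continuous_unitSphereMap f).measurable

/-- **Rotation invariance of the sphere measure**: `Measure.toSphere` of the volume of a
finite-dimensional real inner product space is invariant under every linear isometry,
`f̂_* σ = σ` (the volume is, and the cone over `f̂⁻¹(s)` is `f⁻¹` of the cone over `s`). [folklore] -/
theorem map_unitSphereMap_toSphere (f : E ≃ₗᵢ[ℝ] E) :
    (volume : Measure E).toSphere.map (unitSphereMap f) = (volume : Measure E).toSphere := by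
  ext s hs
  rw [Measure.map_apply (measurable_unitSphereMap f) hs,
    Measure.toSphere_apply' _ ((measurable_unitSphereMap f) hs), Measure.toSphere_apply' _ hs,
    image_val_preimage_unitSphereMap, Ioo_smul_preimage_linearIsometryEquiv]
  congr 1
  rw [← f.coe_toMeasurableEquiv, ← MeasurableEquiv.map_apply, f.coe_toMeasurableEquiv,
    f.measurePreserving.map_eq]

/-- A linear isometry acts on the unit sphere as a measure-preserving map of `Measure.toSphere volume`.
[folklore] -/
theorem measurePreserving_unitSphereMap (f : E ≃ₗᵢ[ℝ] E) :
    MeasurePreserving (unitSphereMap f) (volume : Measure E).toSphere (volume : Measure E).toSphere :=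
  ⟨measurable_unitSphereMap f, map_unitSphereMap_toSphere f⟩

end SphereInvariance

/-! ### API: the record law -/

section RecordLaw

/-- For `S ≠ ∅` the record law is a probability measure on `S^{2M-1}`. [cite: BengtssonZyczkowski2017, §7.5 (7.59)] -/
theorem isProbabilityMeasure_rayMeasure {S : Finset (Fin 3 → ℤ)} (hS : S.Nonempty) :
    IsProbabilityMeasure (rayMeasure S) := by
  haveI : Nonempty ↥S := hS.to_subtype
  haveI : Nontrivial (EuclideanSpace ℂ ↥S) := inferInstance
  refine ⟨?_⟩
  rw [rayMeasure, Measure.smul_apply, smul_eq_mul, ENNReal.inv_mul_cancel]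
  · exact MeasureTheory.Measure.measure_univ_ne_zero.mpr (Measure.toSphere_ne_zero _)
  · exact measure_ne_top _ _

/-- **`U(M)`-invariance of the record law** (indeed invariance under the whole real orthogonal group
of `ℂ^S ≅ ℝ^{2M}`): `f̂_* (rayMeasure S) = rayMeasure S` for every real-linear isometry `f` of `ℂ^S`,
in particular for unitaries `z ↦ Uz` and for coordinatewise phase changes and permutations of the
modes — the symmetry behind `∫ conj(z_n) z_{n'} dσ = δ_{nn'}/M` and the higher sphere moments.
[cite: BengtssonZyczkowski2017, §7.6 (7.64)] -/
theorem map_unitSphereMap_rayMeasure (S : Finset (Fin 3 → ℤ))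
    (f : EuclideanSpace ℂ ↥S ≃ₗᵢ[ℝ] EuclideanSpace ℂ ↥S) :
    (rayMeasure S).map (unitSphereMap f) = rayMeasure S := by
  rw [rayMeasure, Measure.map_smul, map_unitSphereMap_toSphere]

/-- The record law is preserved by every real-linear isometry of `ℂ^S`. [cite: BengtssonZyczkowski2017, §7.6 (7.64)] -/
theorem measurePreserving_unitSphereMap_rayMeasure (S : Finset (Fin 3 → ℤ))
    (f : EuclideanSpace ℂ ↥S ≃ₗᵢ[ℝ] EuclideanSpace ℂ ↥S) :
    MeasurePreserving (unitSphereMap f) (rayMeasure S) (rayMeasure S) :=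
  ⟨measurable_unitSphereMap f, map_unitSphereMap_rayMeasure S f⟩

/-- Change of variables in record averages: `∫ F(f̂ z) dσ(z) = ∫ F(z) dσ(z)` for every real-linear
isometry `f` of `ℂ^S` and every `F ≥ 0`. [cite: BengtssonZyczkowski2017, §7.6 (7.64)] -/
theorem lintegral_comp_unitSphereMap_rayMeasure (S : Finset (Fin 3 → ℤ))
    (f : EuclideanSpace ℂ ↥S ≃ₗᵢ[ℝ] EuclideanSpace ℂ ↥S)
    (F : ↥(sphere (0 : EuclideanSpace ℂ ↥S) 1) → ℝ≥0∞) :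
    ∫⁻ z, F (unitSphereMap f z) ∂rayMeasure S = ∫⁻ z, F z ∂rayMeasure S := by
  have h := measurePreserving_unitSphereMap_rayMeasure S f
  have hemb : MeasurableEmbedding (unitSphereMap f) := by
    refine ⟨?_, measurable_unitSphereMap f, ?_⟩
    · intro a b hab
      have := congrArg (unitSphereMap f.symm) hab
      simpa using this
    · intro s hs
      have hs' : unitSphereMap f '' s = unitSphereMap f.symm ⁻¹' s := by
        ext z
        constructor
        · rintro ⟨w, hw, rfl⟩
          simpa using hw
        · intro hz
          exact ⟨unitSphereMap f.symm z, hz, by simp⟩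
      rw [hs']
      exact measurable_unitSphereMap f.symm hs
  exact h.lintegral_comp_emb hemb F

end RecordLaw

/-! ### API: second moments of the record law (the `m = 1` block of the resolution of the identity) -/

section SphereMoments

variable {E : Type*} [NormedAddCommGroup E] [InnerProductSpace ℝ E] [FiniteDimensional ℝ E]
  [MeasurableSpace E] [BorelSpace E]

omit [FiniteDimensional ℝ E] in
/-- `unitSphereMap f` is a measurable embedding (it is a bijection with measurable inverse
`unitSphereMap f.symm`). [folklore] -/
theorem measurableEmbedding_unitSphereMap (f : E ≃ₗᵢ[ℝ] E) : MeasurableEmbedding (unitSphereMap f) := by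
  refine ⟨?_, measurable_unitSphereMap f, ?_⟩
  · intro a b hab
    have := congrArg (unitSphereMap f.symm) hab
    simpa using this
  · intro s hs
    have hs' : unitSphereMap f '' s = unitSphereMap f.symm ⁻¹' s := by
      ext z
      constructor
      · rintro ⟨w, hw, rfl⟩
        simpa using hw
      · intro hz
        exact ⟨unitSphereMap f.symm z, hz, by simp⟩
    rw [hs']
    exact measurable_unitSphereMap f.symm hs

variable {S : Finset (Fin 3 → ℤ)}

/-- Change of variables in record averages, Bochner form: `∫ F(f̂ z) dσ(z) = ∫ F(z) dσ(z)` for every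
real-linear isometry `f` of `ℂ^S`. [cite: BengtssonZyczkowski2017, §7.6 (7.64)] -/
theorem integral_comp_unitSphereMap_rayMeasure {G : Type*} [NormedAddCommGroup G] [NormedSpace ℝ G]
    (S : Finset (Fin 3 → ℤ)) (f : EuclideanSpace ℂ ↥S ≃ₗᵢ[ℝ] EuclideanSpace ℂ ↥S)
    (F : ↥(sphere (0 : EuclideanSpace ℂ ↥S) 1) → G) :
    ∫ z, F (unitSphereMap f z) ∂rayMeasure S = ∫ z, F z ∂rayMeasure S :=
  (measurePreserving_unitSphereMap_rayMeasure S f).integral_comp (measurableEmbedding_unitSphereMap f) F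

/-- The coordinate functions `z ↦ z_n` are continuous on the record sphere. [folklore] -/
theorem continuous_sphere_coord (n : ↥S) :
    Continuous fun z : ↥(sphere (0 : EuclideanSpace ℂ ↥S) 1) => (z : EuclideanSpace ℂ ↥S) n :=
  (PiLp.continuous_apply 2 (fun _ : ↥S => ℂ) n).comp continuous_subtype_val

/-- `|z_n| ≤ 1` on the unit sphere. [folklore] -/
theorem norm_sphere_coord_le_one (z : ↥(sphere (0 : EuclideanSpace ℂ ↥S) 1)) (n : ↥S) :
    ‖(z : EuclideanSpace ℂ ↥S) n‖ ≤ 1 := by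
  have hz : ‖(z : EuclideanSpace ℂ ↥S)‖ = 1 := mem_sphere_zero_iff_norm.mp z.2
  calc ‖(z : EuclideanSpace ℂ ↥S) n‖ ≤ ‖(z : EuclideanSpace ℂ ↥S)‖ := PiLp.norm_apply_le _ n
    _ = 1 := hz

/-- `∑_n |z_n|² = 1` on the unit sphere of `ℂ^S`. [folklore] -/
theorem sum_norm_sq_sphere_coord (z : ↥(sphere (0 : EuclideanSpace ℂ ↥S) 1)) :
    ∑ n : ↥S, ‖(z : EuclideanSpace ℂ ↥S) n‖ ^ 2 = 1 := by
  have hz : ‖(z : EuclideanSpace ℂ ↥S)‖ = 1 := mem_sphere_zero_iff_norm.mp z.2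
  rw [← EuclideanSpace.norm_sq_eq, hz, one_pow]

/-- The record law is a finite measure (for `S = ∅` it is the zero measure on an empty sphere).
[folklore] -/
theorem isFiniteMeasure_rayMeasure (S : Finset (Fin 3 → ℤ)) : IsFiniteMeasure (rayMeasure S) := by
  refine ⟨?_⟩
  rw [rayMeasure, Measure.smul_apply, smul_eq_mul]
  by_cases hc : (volume : Measure (EuclideanSpace ℂ ↥S)).toSphere Set.univ = 0
  · rw [hc, mul_zero]
    exact zero_lt_one.trans ENNReal.one_lt_top
  · rw [ENNReal.inv_mul_cancel hc (measure_ne_top _ _)]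
    exact ENNReal.one_lt_top

/-- Bounded continuous functions on the record sphere are integrable for the record law. [folklore] -/
theorem integrable_rayMeasure_of_norm_le {G : Type*} [NormedAddCommGroup G]
    {F : ↥(sphere (0 : EuclideanSpace ℂ ↥S) 1) → G} (hF : Continuous F) {C : ℝ}
    (hC : ∀ z, ‖F z‖ ≤ C) : Integrable F (rayMeasure S) := by
  haveI := isFiniteMeasure_rayMeasure S
  exact Integrable.mono' (integrable_const C) hF.aestronglyMeasurable
    (Filter.Eventually.of_forall hC)

/-- **Sum rule**: `∑_n ∫ |z_n|² dσ = 1` (`S ≠ ∅`). [cite: BengtssonZyczkowski2017, §7.5 (7.59)] -/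
theorem sum_integral_norm_sq_sphere_coord (hS : S.Nonempty) :
    ∑ n : ↥S, ∫ z, ‖(z : EuclideanSpace ℂ ↥S) n‖ ^ 2 ∂rayMeasure S = 1 := by
  haveI := isProbabilityMeasure_rayMeasure hS
  have hint : ∀ n : ↥S, Integrable (fun z : ↥(sphere (0 : EuclideanSpace ℂ ↥S) 1) =>
      ‖(z : EuclideanSpace ℂ ↥S) n‖ ^ 2) (rayMeasure S) := fun n =>
    integrable_rayMeasure_of_norm_le ((continuous_sphere_coord n).norm.pow 2) (C := 1) fun z => by
      rw [Real.norm_eq_abs, abs_pow, abs_norm]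
      exact pow_le_one₀ (norm_nonneg _) (norm_sphere_coord_le_one z n)
  rw [← integral_finsetSum _ fun n _ => hint n]
  simp_rw [sum_norm_sq_sphere_coord]
  simp

/-- **Exchangeability of the coordinates**: `∫ |z_n|² dσ = ∫ |z_{n'}|² dσ` (invariance of `σ` under the
coordinate transposition, a real-linear isometry of `ℂ^S`). [cite: BengtssonZyczkowski2017, §7.6 (7.64)] -/
theorem integral_norm_sq_sphere_coord_eq (n n' : ↥S) :
    ∫ z, ‖(z : EuclideanSpace ℂ ↥S) n‖ ^ 2 ∂rayMeasure S =
      ∫ z, ‖(z : EuclideanSpace ℂ ↥S) n'‖ ^ 2 ∂rayMeasure S := by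
  set f : EuclideanSpace ℂ ↥S ≃ₗᵢ[ℝ] EuclideanSpace ℂ ↥S :=
    LinearIsometryEquiv.piLpCongrLeft 2 ℝ ℂ (Equiv.swap n n') with hf
  have h := integral_comp_unitSphereMap_rayMeasure S f
    (fun z => ‖(z : EuclideanSpace ℂ ↥S) n'‖ ^ 2)
  have hcoord : ∀ z : ↥(sphere (0 : EuclideanSpace ℂ ↥S) 1),
      ((unitSphereMap f z : ↥(sphere (0 : EuclideanSpace ℂ ↥S) 1)) : EuclideanSpace ℂ ↥S) n' =
        (z : EuclideanSpace ℂ ↥S) n := by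
    intro z
    rw [coe_unitSphereMap, hf, LinearIsometryEquiv.piLpCongrLeft_apply, Equiv.piCongrLeft'_apply,
      Equiv.symm_swap, Equiv.swap_apply_right]
  simp_rw [hcoord] at h
  exact h

/-- **Second moments, diagonal**: `∫ |z_n|² dσ(z) = 1/M`, `M = |S|`.
[cite: BengtssonZyczkowski2017, §7.5 (7.59)] -/
theorem integral_norm_sq_sphere_coord (hS : S.Nonempty) (n : ↥S) :
    ∫ z, ‖(z : EuclideanSpace ℂ ↥S) n‖ ^ 2 ∂rayMeasure S = (S.card : ℝ)⁻¹ := by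
  have hsum := sum_integral_norm_sq_sphere_coord hS
  rw [Finset.sum_congr rfl fun n' _ => integral_norm_sq_sphere_coord_eq n' n, Finset.sum_const,
    Finset.card_univ, Fintype.card_coe, nsmul_eq_mul] at hsum
  have hM : (S.card : ℝ) ≠ 0 := Nat.cast_ne_zero.mpr hS.card_pos.ne'
  field_simp
  linarith

/-- **Second moments, off-diagonal**: `∫ z_n conj(z_{n'}) dσ(z) = 0` for `n ≠ n'` (invariance of `σ`
under the phase flip `z_n ↦ -z_n`, a real-linear isometry of `ℂ^S`). [cite: BengtssonZyczkowski2017, §7.6 (7.64)] -/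
theorem integral_sphere_coord_mul_conj_of_ne {n n' : ↥S} (hnn' : n ≠ n') :
    ∫ z, (z : EuclideanSpace ℂ ↥S) n * conj ((z : EuclideanSpace ℂ ↥S) n') ∂rayMeasure S = 0 := by
  set e : ∀ _ : ↥S, ℂ ≃ₗᵢ[ℝ] ℂ := fun m => if m = n then LinearIsometryEquiv.neg ℝ else
    LinearIsometryEquiv.refl ℝ ℂ with he
  set f : EuclideanSpace ℂ ↥S ≃ₗᵢ[ℝ] EuclideanSpace ℂ ↥S := LinearIsometryEquiv.piLpCongrRight 2 e
    with hf
  have h := integral_comp_unitSphereMap_rayMeasure S f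
    (fun z => (z : EuclideanSpace ℂ ↥S) n * conj ((z : EuclideanSpace ℂ ↥S) n'))
  have hn : ∀ z : ↥(sphere (0 : EuclideanSpace ℂ ↥S) 1),
      ((unitSphereMap f z : ↥(sphere (0 : EuclideanSpace ℂ ↥S) 1)) : EuclideanSpace ℂ ↥S) n =
        -(z : EuclideanSpace ℂ ↥S) n := by
    intro z
    rw [coe_unitSphereMap, hf, LinearIsometryEquiv.piLpCongrRight_apply, PiLp.toLp_apply, he]
    simp
  have hn' : ∀ z : ↥(sphere (0 : EuclideanSpace ℂ ↥S) 1),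
      ((unitSphereMap f z : ↥(sphere (0 : EuclideanSpace ℂ ↥S) 1)) : EuclideanSpace ℂ ↥S) n' =
        (z : EuclideanSpace ℂ ↥S) n' := by
    intro z
    rw [coe_unitSphereMap, hf, LinearIsometryEquiv.piLpCongrRight_apply, PiLp.toLp_apply, he]
    simp [Ne.symm hnn']
  simp_rw [hn, hn', neg_mul, integral_neg] at h
  -- h : -I = I
  have h2 : (2 : ℂ) * ∫ z, (z : EuclideanSpace ℂ ↥S) n * conj ((z : EuclideanSpace ℂ ↥S) n')
      ∂rayMeasure S = 0 := by
    rw [two_mul]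
    nth_rewrite 1 [← h]
    ring
  exact (mul_eq_zero.mp h2).resolve_left two_ne_zero

/-- **The second moments of the record law**: `∫ z_n conj(z_{n'}) dσ(z) = δ_{nn'}/M` — in operator
form `M ∫ |ψ_z⟩⟨ψ_z| dσ(z) = P_S`, the `m = 1` block (`c_1 = M`) of the resolution of the identity
behind the POVM property of `K_z`. [cite: BengtssonZyczkowski2017, §7.5 (7.59)] -/
theorem integral_sphere_coord_mul_conj (hS : S.Nonempty) (n n' : ↥S) :
    ∫ z, (z : EuclideanSpace ℂ ↥S) n * conj ((z : EuclideanSpace ℂ ↥S) n') ∂rayMeasure S =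
      if n = n' then ((S.card : ℂ))⁻¹ else 0 := by
  split_ifs with h
  · subst h
    have hre : ∀ z : ↥(sphere (0 : EuclideanSpace ℂ ↥S) 1),
        (z : EuclideanSpace ℂ ↥S) n * conj ((z : EuclideanSpace ℂ ↥S) n) =
          ((‖(z : EuclideanSpace ℂ ↥S) n‖ ^ 2 : ℝ) : ℂ) := fun z => by
      rw [Complex.mul_conj, Complex.normSq_eq_norm_sq]
    simp_rw [hre]
    rw [integral_complex_ofReal, integral_norm_sq_sphere_coord hS n]
    simp
  · exact integral_sphere_coord_mul_conj_of_ne h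

end SphereMoments

/-! ### API: the one-particle operators `P_z`, `P_S` written out -/

section OneParticleOperators

variable {L : ℝ} {S : Finset (Fin 3 → ℤ)}

/-- The ray mode is continuous. [folklore] -/
theorem continuous_rayMode (L : ℝ) (S : Finset (Fin 3 → ℤ)) (z : EuclideanSpace ℂ ↥S) :
    Continuous (rayMode L S z) := by
  unfold rayMode
  exact continuous_finsetSum _ fun n _ => continuous_const.mul (continuous_planeWaveMode L _)

/-- **`P_z` in the particle `i`, factorised**: `(P_z)ᵢΦ(X) = ψ_z(xᵢ) · ∫_{cell} conj(ψ_z(y)) Φ(X[xᵢ := y]) dy`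
(rank one: the `xᵢ`-dependence is `ψ_z(xᵢ)`). [cite: BengtssonZyczkowski2017, §10.1 (10.18)] -/
theorem kernelProj_singleton_rayKernel (L : ℝ) (S : Finset (Fin 3 → ℤ)) (z : EuclideanSpace ℂ ↥S)
    (i : Fin N) (Φ : Config N → ℂ) (X : Config N) :
    kernelProj L {i} (fun _ => rayKernel L S z) Φ X =
      rayMode L S z (X i) * ∫ y in cell L, conj (rayMode L S z y) * Φ (Function.update X i y) := by
  rw [kernelProj_singleton]
  simp only [rayKernel, mul_assoc]
  exact integral_const_mul _ _

/-- **`P_S` in the particle `i`, written out** for continuous `Φ`: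
`(P_S)ᵢΦ(X) = ∑_{n∈S} φ_n(xᵢ) ∫_{cell} conj(φ_n(y)) Φ(X[xᵢ := y]) dy` (finite sum of rank-one terms).
[cite: LiebSeiringer2006, Sect. 3 Step 3] -/
theorem kernelProj_singleton_coarseKernel (L : ℝ) (S : Finset (Fin 3 → ℤ)) (i : Fin N)
    {Φ : Config N → ℂ} (hΦ : Continuous Φ) (X : Config N) :
    kernelProj L {i} (fun _ => coarseKernel L S) Φ X =
      ∑ n ∈ S, planeWaveMode L n (X i) *
        ∫ y in cell L, conj (planeWaveMode L n y) * Φ (Function.update X i y) := by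
  rw [kernelProj_singleton]
  simp only [coarseKernel, Finset.sum_mul, mul_assoc]
  have hslice : Continuous fun y : Space => Φ (Function.update X i y) :=
    hΦ.comp (continuous_const.update i continuous_id)
  rw [integral_finsetSum _ fun n _ => ?_]
  · exact Finset.sum_congr rfl fun n _ => integral_const_mul _ _
  · exact integrableOn_cell ((continuous_const.mul ((Complex.continuous_conj.comp
      (continuous_planeWaveMode L n)).mul hslice)))

end OneParticleOperators

end Literature.MathematicalPhysics.QuantumManyBody.BoseGas
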